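import Summits.RiemannHypothesis.RiemannHypothesis.Theorems.GroundBartaEvenWinsBeyondArchDeflationSigma
import Summits.RiemannHypothesis.RiemannHypothesis.Theorems.GroundBartaEvenWinsBeyondArchDeflationPSDFromBoundsM
import HarnessLib

/-!
# RiemannHypothesis / GroundBarta — rung 4 (`EvenWinsBeyondArch`, items 18807 / 18085):
# the deflated Temple L-side with the FULL residual Gram matrix — the cross-Gram criterion

Helper file (`--supports stmt-RiemannHypothesis-18085`), RH-free, Mathlib + landed tree files only, no definitions, no named facts.  Prover A (gen 4 of unit `sr-gb-rung-a`).

WHY.  The sigma criterion (file …DeflationSigma, `dt_psd_of_sigma`) replaces the residual Gram matrix `R_ij = Re⟨r_i, r_j⟩`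
of the deflated Temple bound by the rank-one worst case `Σ_i s_i/θ_i · diag θ`; it is tight only when the residuals are
parallel.  For the ladder cell `[3/4, 77/100]` prover B's certified norms give `Σ s_i/T_i = 1.105 > 1` (infeasible), but
the residuals of the six degree-55 Ritz vectors at `b = 0.77` are far from parallel (measured correlations `0.69, 0.15,
0.76` among modes `0,1,2`), and the true condition `(β−λ)(A−λG) − R ⪰ 0` holds with `λ_max = 0.71`.  This file supplies
the Lean side of that sharper test:

* `dt_abs_cross_le` — the elementary two-sided box `|Re⟨f, g⟩| ≤ (t‖f‖² + t⁻¹‖g‖²)/2` (any `t > 0`) for the cross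
  terms NOT certified by the R-layer (no Cauchy–Schwarz in `L²` needed: `‖t f ± g‖² ≥ 0` pointwise);
* `dt_psd_of_crossGram` — `N − R ⪰ 0` follows from `N − R' ⪰ 0` where `R'` has the certified UPPER bounds `s_i` on the
  diagonal and the true cross terms off the diagonal (monotonicity in the diagonal);
* `dt_hN_of_bounds₃` / `dt_hN_of_boundsT₃` — the kernel certificate (corner checks `hPE`, by `decide`) of `N − R' ⪰ 0` from entrywise boxes:
  A-layer bounds `Alo ≤ A ≤ Ahi` (or Markov-free `Tlo ≤ P₂+𝓔₂ ≤ Thi` with `M_c ≤ Mhi`, antitone in `M_c`), the `β`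
  bracket, exact `G`, and boxes `Rlo ≤ R' ≤ Rhi` (two-sided certified cross integrals from the R-layer, the boxes of
  `dt_abs_cross_le` for the rest, `[s_i, s_i]` on the diagonal), via the scaled `LᵀDL` certificate
  `dt_psd_of_scaledCertificate`.

References: N. J. Lehmann, Numer. Math. 5 (1963) 246–272; F. Goerisch, H. Haunhorst, ZAMM 65 (1985) 129–135;
S. M. Rump, BIT 46 (2006) 433–452 (verification of positive definiteness).
-/

set_option linter.dupNamespace false

noncomputable section

open MeasureTheory Set Filter Finset
open scoped Topology ENNReal NNReal ComplexConjugate BigOperators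

namespace Summit.RiemannHypothesis.RiemannHypothesis.Theorems.EvenWinsBeyondArch

open Literature.NumberTheory.LFunctions

/-! ## Boxes for uncertified cross terms -/

/-- **Two-sided box for a cross integral from the two norms**: for `f, g ∈ L²` with `∫‖f‖² ≤ s_f`, `∫‖g‖² ≤ s_g` and any
`t > 0`, `|∫ Re(f ḡ)| ≤ (t·s_f + s_g/t)/2` (from `‖t f ± g‖² ≥ 0` pointwise; `t = √(s_g/s_f)` gives `√(s_f s_g)`). [folklore] -/
theorem dt_abs_cross_le {f g : ℝ → ℂ} (hf : MemLp f 2) (hg : MemLp g 2) {sf sg t : ℝ} (ht : 0 < t)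
    (hsf : ∫ x, ‖f x‖ ^ 2 ≤ sf) (hsg : ∫ x, ‖g x‖ ^ 2 ≤ sg) :
    |∫ x, (f x * conj (g x)).re| ≤ (t * sf + sg / t) / 2 := by
  have hint : Integrable fun x ↦ (f x * conj (g x)).re := dt_integrable_mul_conj_re hf hg
  have hsqf : Integrable fun x ↦ ‖f x‖ ^ 2 := (memLp_two_iff_integrable_sq_norm hf.1).1 hf
  have hsqg : Integrable fun x ↦ ‖g x‖ ^ 2 := (memLp_two_iff_integrable_sq_norm hg.1).1 hg
  -- pointwise: ± 2 t Re(f ḡ) ≤ t² ‖f‖² + ‖g‖²  (from ‖t f ∓ g‖² ≥ 0)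
  have hpt : ∀ (ε : ℝ), ε = 1 ∨ ε = -1 → ∀ x, ε * (2 * t) * (f x * conj (g x)).re ≤ t ^ 2 * ‖f x‖ ^ 2 + ‖g x‖ ^ 2 := by
    intro ε hε x
    have h0 : 0 ≤ Complex.normSq ((t : ℂ) * f x + ((-ε : ℝ) : ℂ) * g x) := Complex.normSq_nonneg _
    rw [Complex.normSq_add] at h0
    have e1 : Complex.normSq ((t : ℂ) * f x) = t ^ 2 * ‖f x‖ ^ 2 := by
      rw [Complex.normSq_mul, Complex.normSq_ofReal, Complex.normSq_eq_norm_sq]; ring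
    have e2 : Complex.normSq (((-ε : ℝ) : ℂ) * g x) = ‖g x‖ ^ 2 := by
      rw [Complex.normSq_mul, Complex.normSq_ofReal, Complex.normSq_eq_norm_sq]
      rcases hε with h | h <;> simp [h]
    have e3 : ((t : ℂ) * f x * conj (((-ε : ℝ) : ℂ) * g x)).re = -(t * ε) * (f x * conj (g x)).re := by
      rw [map_mul, Complex.conj_ofReal]
      have : (t : ℂ) * f x * (((-ε : ℝ) : ℂ) * conj (g x)) = ((-(t * ε) : ℝ) : ℂ) * (f x * conj (g x)) := by
        push_cast; ring
      rw [this, Complex.re_ofReal_mul]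
    rw [e1, e2, e3] at h0
    linarith
  have hI : ∀ (ε : ℝ), ε = 1 ∨ ε = -1 → ε * (2 * t) * ∫ x, (f x * conj (g x)).re ≤ t ^ 2 * sf + sg := by
    intro ε hε
    have hmono := integral_mono (f := fun x ↦ ε * (2 * t) * (f x * conj (g x)).re)
      (g := fun x ↦ t ^ 2 * ‖f x‖ ^ 2 + ‖g x‖ ^ 2) (hint.const_mul (ε * (2 * t)))
      ((hsqf.const_mul (t ^ 2)).add hsqg) (fun x ↦ hpt ε hε x)
    rw [integral_const_mul, integral_add (hsqf.const_mul _) hsqg, integral_const_mul] at hmono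
    nlinarith [hmono, hsf, hsg, sq_nonneg t]
  have h1 := hI 1 (Or.inl rfl)
  have h2 := hI (-1) (Or.inr rfl)
  have hq : (t * sf + sg / t) / 2 * (2 * t) = t ^ 2 * sf + sg := by
    field_simp
  rw [abs_le]
  constructor
  · -- lower: -(t sf + sg/t)/2 ≤ I  ⇐  -2tI ≤ t² sf + sg
    have key : -((t * sf + sg / t) / 2) * (2 * t) ≤ (∫ x, (f x * conj (g x)).re) * (2 * t) := by
      rw [neg_mul, hq]; linarith
    exact le_of_mul_le_mul_right key (by linarith)
  · have key : (∫ x, (f x * conj (g x)).re) * (2 * t) ≤ (t * sf + sg / t) / 2 * (2 * t) := by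
      rw [hq]; linarith
    exact le_of_mul_le_mul_right key (by linarith)

/-! ## The cross-Gram criterion: replace the diagonal of `R` by its certified upper bounds -/

/-- **The cross-Gram criterion.**  If `s_i ≥ ‖r_i‖²₂` and `N − R' ⪰ 0` for the matrix `R'` with `R'_ii = s_i` and
`R'_ij = Re⟨r_i, r_j⟩` (`i ≠ j`), then `N − Gram(r) ⪰ 0`. [folklore] -/
theorem dt_psd_of_crossGram {k : ℕ} (N : Fin k → Fin k → ℝ) (r : Fin k → ℝ → ℂ) (s : Fin k → ℝ)
    (hs : ∀ i, ∫ x, ‖r i x‖ ^ 2 ≤ s i)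
    (hN : ∀ α : Fin k → ℝ, 0 ≤ ∑ i, ∑ j, α i * α j *
      (N i j - if i = j then s i else ∫ x, (r i x * conj (r j x)).re))
    (α : Fin k → ℝ) :
    0 ≤ ∑ i, ∑ j, α i * α j * (N i j - ∫ x, (r i x * conj (r j x)).re) := by
  have hsplit : ∑ i, ∑ j, α i * α j * (N i j - ∫ x, (r i x * conj (r j x)).re) =
      (∑ i, ∑ j, α i * α j * (N i j - if i = j then s i else ∫ x, (r i x * conj (r j x)).re)) +
        ∑ i, α i ^ 2 * (s i - ∫ x, ‖r i x‖ ^ 2) := by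
    rw [← Finset.sum_add_distrib]
    refine Finset.sum_congr rfl fun i _ ↦ ?_
    have hi : ∑ j, α i * α j * (N i j - ∫ x, (r i x * conj (r j x)).re) =
        ∑ j, (α i * α j * (N i j - if i = j then s i else ∫ x, (r i x * conj (r j x)).re) +
          (if i = j then α i ^ 2 * (s i - ∫ x, ‖r i x‖ ^ 2) else 0)) := by
      refine Finset.sum_congr rfl fun j _ ↦ ?_
      split_ifs with hij
      · subst hij; rw [dt_pairing_self]; ring
      · ring
    rw [hi, Finset.sum_add_distrib, Finset.sum_ite_eq Finset.univ i, if_pos (Finset.mem_univ i)]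
  rw [hsplit]
  have h2 : 0 ≤ ∑ i, α i ^ 2 * (s i - ∫ x, ‖r i x‖ ^ 2) :=
    Finset.sum_nonneg fun i _ ↦ mul_nonneg (sq_nonneg _) (by linarith [hs i])
  linarith [hN α]

/-! ## `N − R' ⪰ 0` from entrywise boxes and the scaled kernel certificate -/

/-- **`N − R' ⪰ 0` from entrywise bounds on `A`, an interval `[βlo, βhi] ∋ β`, exact `G`, boxes `Rlo ≤ R' ≤ Rhi`, and the
scaled kernel certificate.** [folklore] -/
theorem dt_hN_of_bounds₃ {k m : ℕ} (A : Fin k → Fin k → ℝ) (Alo Ahi G : Fin k → Fin k → ℚ)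
    (hA : ∀ i j, (Alo i j : ℝ) ≤ A i j ∧ A i j ≤ (Ahi i j : ℝ)) (Gr : Fin k → Fin k → ℝ) (hG : ∀ i j, Gr i j = G i j)
    {β : ℝ} (βlo βhi : ℚ) (hβ : (βlo : ℝ) ≤ β ∧ β ≤ (βhi : ℝ))
    (Rm : Fin k → Fin k → ℝ) (Rlo Rhi : Fin k → Fin k → ℚ) (hR : ∀ i j, (Rlo i j : ℝ) ≤ Rm i j ∧ Rm i j ≤ (Rhi i j : ℝ))
    (lam : ℚ) (s : Fin k → ℚ) (hs : ∀ i, 0 < s i) (P E : Fin k → Fin k → ℚ) (D : Fin m → ℚ) (L : Fin m → Fin k → ℚ)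
    (δ : ℚ)
    (hPE : ∀ i j, ∀ β' ∈ [βlo, βhi], ∀ a ∈ [Alo i j, Ahi i j],
      P i j - E i j ≤ s i * s j * nEntry β' lam (G i j) (Rhi i j) a ∧
        s i * s j * nEntry β' lam (G i j) (Rlo i j) a ≤ P i j + E i j)
    (hrow : ∀ i, ∑ j, E i j ≤ δ) (hcol : ∀ j, ∑ i, E i j ≤ δ)
    (hD : ∀ r, 0 ≤ D r) (hP : ∀ i j, P i j = δ * (if i = j then 1 else 0) + ∑ r, D r * L r i * L r j)
    (α : Fin k → ℝ) :
    0 ≤ ∑ i, ∑ j, α i * α j * ((β - lam) * (A i j - (lam : ℝ) * Gr i j) - Rm i j) := by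
  refine dt_psd_of_scaledCertificate _ s hs P E D L δ (fun i j ↦ ?_) hrow hcol hD hP α
  obtain ⟨ha1, ha2⟩ := hA i j
  obtain ⟨hr1, hr2⟩ := hR i j
  have hss : (0 : ℝ) < (s i : ℝ) * s j := by
    have := hs i; have := hs j; positivity
  rw [hG i j]
  have c := fun (β' : ℚ) (hβ' : β' ∈ [βlo, βhi]) (a : ℚ) (ha : a ∈ [Alo i j, Ahi i j]) ↦ hPE i j β' hβ' a ha
  have mlo : βlo ∈ [βlo, βhi] := by simp
  have mhi : βhi ∈ [βlo, βhi] := by simp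
  have alo : Alo i j ∈ [Alo i j, Ahi i j] := by simp
  have ahi : Ahi i j ∈ [Alo i j, Ahi i j] := by simp
  obtain ⟨c1, c5⟩ := c βlo mlo (Alo i j) alo
  obtain ⟨c2, c6⟩ := c βlo mlo (Ahi i j) ahi
  obtain ⟨c3, c7⟩ := c βhi mhi (Alo i j) alo
  obtain ⟨c4, c8⟩ := c βhi mhi (Ahi i j) ahi
  unfold nEntry at c1 c2 c3 c4 c5 c6 c7 c8
  have c1r := (Rat.cast_le (K := ℝ)).2 c1
  have c2r := (Rat.cast_le (K := ℝ)).2 c2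
  have c3r := (Rat.cast_le (K := ℝ)).2 c3
  have c4r := (Rat.cast_le (K := ℝ)).2 c4
  have c5r := (Rat.cast_le (K := ℝ)).2 c5
  have c6r := (Rat.cast_le (K := ℝ)).2 c6
  have c7r := (Rat.cast_le (K := ℝ)).2 c7
  have c8r := (Rat.cast_le (K := ℝ)).2 c8
  push_cast at c1r c2r c3r c4r c5r c6r c7r c8r
  -- the bilinear part y·x lies between the corner values; then subtract Rm ∈ [Rlo, Rhi]
  have key := mul_mem_corners (y := β - lam) (ylo := (βlo : ℝ) - lam) (yhi := (βhi : ℝ) - lam)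
    (x := A i j - (lam : ℝ) * G i j) (xlo := (Alo i j : ℝ) - lam * G i j) (xhi := (Ahi i j : ℝ) - lam * G i j)
    (m := ((P i j : ℝ) - E i j) / (s i * s j) + Rhi i j) (M := ((P i j : ℝ) + E i j) / (s i * s j) + Rlo i j)
    (by linarith [hβ.1]) (by linarith [hβ.2]) (by linarith) (by linarith)
    (by rw [div_add' _ _ _ hss.ne', div_le_iff₀ hss]; nlinarith [c1r])
    (by rw [div_add' _ _ _ hss.ne', div_le_iff₀ hss]; nlinarith [c2r])
    (by rw [div_add' _ _ _ hss.ne', div_le_iff₀ hss]; nlinarith [c3r])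
    (by rw [div_add' _ _ _ hss.ne', div_le_iff₀ hss]; nlinarith [c4r])
    (by rw [div_add' _ _ _ hss.ne', le_div_iff₀ hss]; nlinarith [c5r])
    (by rw [div_add' _ _ _ hss.ne', le_div_iff₀ hss]; nlinarith [c6r])
    (by rw [div_add' _ _ _ hss.ne', le_div_iff₀ hss]; nlinarith [c7r])
    (by rw [div_add' _ _ _ hss.ne', le_div_iff₀ hss]; nlinarith [c8r])
  obtain ⟨k1, k2⟩ := key
  rw [div_add' _ _ _ hss.ne', div_le_iff₀ hss] at k1
  rw [div_add' _ _ _ hss.ne', le_div_iff₀ hss] at k2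
  rw [abs_le]
  constructor <;> nlinarith

/-- **`N − R' ⪰ 0` from Markov-free entry bounds** (`Tlo ≤ P₂ + 𝓔₂ ≤ Thi`, `M_c ≤ Mhi`, exact `G ⪰ 0` by an exact
factorisation, `β` bracket, boxes `Rlo ≤ R' ≤ Rhi`, kernel certificate for the entries `Tlo/Thi − Mhi·G`): the matrix
`(β−λ)((A' − M G) − λG) − R'` is antitone in `M`. [folklore] -/
theorem dt_hN_of_boundsT₃ {k m mG : ℕ} (Ap : Fin k → Fin k → ℝ) (Tlo Thi G : Fin k → Fin k → ℚ)
    (hAp : ∀ i j, (Tlo i j : ℝ) ≤ Ap i j ∧ Ap i j ≤ (Thi i j : ℝ)) (Gr : Fin k → Fin k → ℝ) (hG : ∀ i j, Gr i j = G i j)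
    {M : ℝ} (Mhi : ℚ) (hM : M ≤ (Mhi : ℝ))
    (DG : Fin mG → ℚ) (LG : Fin mG → Fin k → ℚ) (hDG : ∀ r, 0 ≤ DG r)
    (hLG : ∀ i j, G i j = 0 * (if i = j then 1 else 0) + ∑ r, DG r * LG r i * LG r j)
    {β : ℝ} (βlo βhi : ℚ) (hβ : (βlo : ℝ) ≤ β ∧ β ≤ (βhi : ℝ))
    (Rm : Fin k → Fin k → ℝ) (Rlo Rhi : Fin k → Fin k → ℚ) (hR : ∀ i j, (Rlo i j : ℝ) ≤ Rm i j ∧ Rm i j ≤ (Rhi i j : ℝ))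
    (lam : ℚ) (hlam : lam < βlo) (s : Fin k → ℚ) (hs : ∀ i, 0 < s i) (P E : Fin k → Fin k → ℚ) (D : Fin m → ℚ)
    (L : Fin m → Fin k → ℚ) (δ : ℚ)
    (hPE : ∀ i j, ∀ β' ∈ [βlo, βhi], ∀ a ∈ [Tlo i j - Mhi * G i j, Thi i j - Mhi * G i j],
      P i j - E i j ≤ s i * s j * nEntry β' lam (G i j) (Rhi i j) a ∧
        s i * s j * nEntry β' lam (G i j) (Rlo i j) a ≤ P i j + E i j)
    (hrow : ∀ i, ∑ j, E i j ≤ δ) (hcol : ∀ j, ∑ i, E i j ≤ δ)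
    (hD : ∀ r, 0 ≤ D r) (hP : ∀ i j, P i j = δ * (if i = j then 1 else 0) + ∑ r, D r * L r i * L r j)
    (α : Fin k → ℝ) :
    0 ≤ ∑ i, ∑ j, α i * α j *
      ((β - lam) * ((Ap i j - M * Gr i j) - (lam : ℝ) * Gr i j) - Rm i j) := by
  have hlamβ : (lam : ℝ) < β := lt_of_lt_of_le (by exact_mod_cast hlam) hβ.1
  have h1 := dt_hN_of_bounds₃ (fun i j ↦ Ap i j - (Mhi : ℝ) * Gr i j) (fun i j ↦ Tlo i j - Mhi * G i j)
    (fun i j ↦ Thi i j - Mhi * G i j) G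
    (fun i j ↦ by
      obtain ⟨a1, a2⟩ := hAp i j
      rw [hG i j]; push_cast; constructor <;> linarith)
    Gr hG βlo βhi hβ Rm Rlo Rhi hR lam s hs P E D L δ hPE hrow hcol hD hP α
  have hGpsd : 0 ≤ ∑ i, ∑ j, α i * α j * Gr i j := by
    have h := dt_psd_of_scaledCertificate (fun i j ↦ Gr i j) (fun _ ↦ (1 : ℚ)) (fun _ ↦ by norm_num) G
      (fun _ _ ↦ (0 : ℚ)) DG LG 0 (fun i j ↦ by rw [hG i j]; push_cast; simp) (fun i ↦ by simp) (fun j ↦ by simp) hDG hLG α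
    simpa using h
  have hsplit : ∑ i, ∑ j, α i * α j *
        ((β - lam) * ((Ap i j - M * Gr i j) - (lam : ℝ) * Gr i j) - Rm i j) =
      (∑ i, ∑ j, α i * α j *
        ((β - lam) * ((Ap i j - (Mhi : ℝ) * Gr i j) - (lam : ℝ) * Gr i j) - Rm i j)) +
      (β - lam) * ((Mhi : ℝ) - M) * ∑ i, ∑ j, α i * α j * Gr i j := by
    rw [Finset.mul_sum, ← Finset.sum_add_distrib]
    refine Finset.sum_congr rfl fun i _ ↦ ?_
    rw [Finset.mul_sum, ← Finset.sum_add_distrib]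
    refine Finset.sum_congr rfl fun j _ ↦ ?_
    ring
  rw [hsplit]
  have h2 : 0 ≤ (β - lam) * ((Mhi : ℝ) - M) * ∑ i, ∑ j, α i * α j * Gr i j :=
    mul_nonneg (mul_nonneg (by linarith) (by linarith)) hGpsd
  linarith

end Summit.RiemannHypothesis.RiemannHypothesis.Theorems.EvenWinsBeyondArch

end
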